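import Mathlib
import Summits.NavierStokesRegularity.NavierStokesRegularity.Theorems.WakeRatchetTailRatchetPostFiringCauchy
import Summits.NavierStokesRegularity.NavierStokesRegularity.Theorems.WakeRatchetTailRatchetPostFiringClockUpper
import Summits.NavierStokesRegularity.NavierStokesRegularity.Theorems.WakeRatchetTailRatchetPostFiringSpeedLimit
import HarnessLib

/-!
# `WakeRatchet.TailRatchet` (stmt-NavierStokesRegularity-21808), door D4′ — the UNCONDITIONAL firing clock of the
# one-shell dyadic Cauchy blow-up: existence, monotonicity, leading edge, two-sided clock bracket

Def-free support lemmas (MODEL lattice ODEs: the scalar dyadic member of Tao 2016 §1.2 / §4 in the renormalised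
variables of §6.4; nothing here concerns the Navier–Stokes equations; stmt-21808 is neither proved nor refuted here
and no stub of skeleton d00b85951d7c is closed).

The object of the construction `DyadicCauchyPostFiringBound` (door D4′) is a solution bundle `(T*, X)` of the shape
delivered by `WakeRatchetDyadicCauchy.dyadic_blowup_typeI` (law on `(−δ₀,T*)`, regular below `T*`, non-negative,
type-I frame bound, lower rate) through a non-negative datum vanishing off shell `0`.  In the tree the first-firing
clock of its renormalised frame `W_n(σ) = Λⁿ e^{−σ} X_n(T* − e^{−σ})` was available only under the post-firing
hypothesis (D′) (`postFiringDecay_body_of_cauchy` + `exists_firstFiring`).  Here: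

* `cauchy_body` — the (D)-free part of `postFiringDecay_body_of_cauchy`: law on `σ > −log(T*+δ₀)`, `0 ≤ W ≤ B`
  (`B = 2Λ²/(Λ−1)²`) on `σ ≥ −log T*`, quiet start, lower rate at level `c = 1/(2(Λ+Λ⁻¹))`, `Λc < 1`;
* `cauchy_firstFiring_clock` — **unconditionally**, for every `ε₀ > 0` and every such bundle: the first-firing
  log-times `s_n` (`W_n(s_n) ≥ c`, minimal) exist for all `n`, are monotone with `s_0 = −log T*`, the LEADING EDGE
  `W_{N+1+i}(σ) ≤ Λ⁻¹(Λc)^{2^i}` holds on `[s_N, s_{N+1})`, and the clock is bracketed by the speed limit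
  `s_{N+2m} ≥ s_N + m·c(1−Λc)/(ΛB²)` and the energy line `s_{N+1} ≤ σ` whenever `Λ^N e^{−σ}√E < c`
  (`E` = conserved physical energy) — assembled from `…PostFiringLeadingEdge`, `…SpeedLimit`, `…ClockUpper`.

What door D4′ still asks of this clock is the bounded GAP / band-quiet-time statement ((G)/(BAND) ⟸ (D)), census
CENSUS-21808-leafhand4-g17.md.

HONEST FRAMING: elementary; (D)/(QT)/(G) are NOT proved here; rung 0.
-/

noncomputable section

set_option linter.dupNamespace false

namespace Summit.NavierStokesRegularity.NavierStokesRegularity.Theorems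

namespace WakeRatchetDyadicPostFiring

open Set Filter Topology
open Literature.Analysis.FluidPDE Literature.Analysis.FluidPDE.TaoCascade
open WakeRatchetFiringClock

/-- **The renormalised one-shell Cauchy blow-up: the (D)-free hypotheses of the door's half-line setting.**
With `Λ = bigLam ε₀`, `W_n(σ) = Λⁿ e^{−σ} X_n(T* − e^{−σ})`, `A₀ = −log(T*+δ₀)`, `A = −log T*`,
`B = 2Λ²/(Λ−1)²`, `c = 1/(2(Λ+Λ⁻¹))`: law on `σ > A₀`, `0 ≤ W ≤ B` on `σ ≥ A`, negative shells vanish, quiet start,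
lower rate at level `c`, and `Λc < 1`.
[cite: Tao2016AveragedNS, §1.2, §4 Lemma 4.1 (4.8) with `m = 1`, §6.4; elementary] -/
theorem cauchy_body {ε₀ : ℝ} (hε₀ : 0 < ε₀) {δ₀ Tstar : ℝ} (hδ₀ : 0 < δ₀)
    (hT : 0 < Tstar) {X : ℤ → ℝ → ℝ}
    (hdata : ∀ n : ℤ, n ≠ 0 → X n 0 = 0)
    (hlaw : ∀ n : ℤ, ∀ t ∈ Ioo (-δ₀) Tstar, HasDerivAt (X n)
      (bigLam ε₀ ^ (n - 1) * X (n - 1) t ^ 2 - bigLam ε₀ ^ n * X n t * X (n + 1) t) t)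
    (hreg : ∀ T', T' < Tstar → ∃ B : ℝ, ∀ n : ℤ, ∀ t ∈ Ioo (-δ₀) T', |bigLam ε₀ ^ n * X n t| ≤ B)
    (hnn : ∀ n : ℤ, ∀ t ∈ Ico 0 Tstar, 0 ≤ X n t)
    (htypeI : ∀ n : ℤ, ∀ t ∈ Ico 0 Tstar,
      bigLam ε₀ ^ n * X n t * (Tstar - t) ≤ 2 * bigLam ε₀ ^ 2 / (bigLam ε₀ - 1) ^ 2)
    (hlow : ∀ t ∈ Ioo (-δ₀) Tstar, ∀ β : ℝ, 0 < β →
      (∀ n : ℤ, |bigLam ε₀ ^ n * X n t| ≤ β) → 1 ≤ (bigLam ε₀ + (bigLam ε₀)⁻¹) * β * (Tstar - t)) :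
    -Real.log (Tstar + δ₀) < -Real.log Tstar ∧
    0 < 1 / (2 * (bigLam ε₀ + (bigLam ε₀)⁻¹)) ∧
    bigLam ε₀ * (1 / (2 * (bigLam ε₀ + (bigLam ε₀)⁻¹))) < 1 ∧
    (∀ (n : ℤ) (σ : ℝ), -Real.log (Tstar + δ₀) < σ →
      HasDerivAt (fun σ => bigLam ε₀ ^ n * (Real.exp (-σ) * X n (Tstar - Real.exp (-σ))))
        (-(bigLam ε₀ ^ n * (Real.exp (-σ) * X n (Tstar - Real.exp (-σ))))
          + bigLam ε₀ * (bigLam ε₀ ^ (n - 1) * (Real.exp (-σ) * X (n - 1) (Tstar - Real.exp (-σ)))) ^ 2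
          - (bigLam ε₀)⁻¹ * (bigLam ε₀ ^ n * (Real.exp (-σ) * X n (Tstar - Real.exp (-σ))))
            * (bigLam ε₀ ^ (n + 1) * (Real.exp (-σ) * X (n + 1) (Tstar - Real.exp (-σ))))) σ) ∧
    (∀ (n : ℤ) (σ : ℝ), -Real.log Tstar ≤ σ →
      0 ≤ bigLam ε₀ ^ n * (Real.exp (-σ) * X n (Tstar - Real.exp (-σ))) ∧
      bigLam ε₀ ^ n * (Real.exp (-σ) * X n (Tstar - Real.exp (-σ))) ≤ 2 * bigLam ε₀ ^ 2 / (bigLam ε₀ - 1) ^ 2) ∧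
    (∀ n : ℤ, n < 0 → ∀ σ : ℝ, -Real.log Tstar ≤ σ →
      bigLam ε₀ ^ n * (Real.exp (-σ) * X n (Tstar - Real.exp (-σ))) = 0) ∧
    (∀ n : ℤ, 0 < n →
      bigLam ε₀ ^ n * (Real.exp (-(-Real.log Tstar)) * X n (Tstar - Real.exp (-(-Real.log Tstar)))) = 0) ∧
    (∀ σ : ℝ, -Real.log Tstar ≤ σ → ∃ n : ℤ,
      1 / (2 * (bigLam ε₀ + (bigLam ε₀)⁻¹)) ≤ bigLam ε₀ ^ n * (Real.exp (-σ) * X n (Tstar - Real.exp (-σ)))) := by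
  set Λ : ℝ := bigLam ε₀ with hΛdef
  have hΛ1 : 1 < Λ := by
    rw [hΛdef]; unfold bigLam; exact Real.one_lt_rpow (by linarith) (by norm_num)
  have hΛ0 : 0 < Λ := by linarith
  have hL : 0 < Λ + Λ⁻¹ := by positivity
  set A₀ : ℝ := -Real.log (Tstar + δ₀) with hA₀
  set A : ℝ := -Real.log Tstar with hA
  have hexpA : Real.exp (-A) = Tstar := by rw [hA, neg_neg, Real.exp_log hT]
  have hexpA₀ : Real.exp (-A₀) = Tstar + δ₀ := by rw [hA₀, neg_neg, Real.exp_log (by linarith)]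
  have htime_lt : ∀ σ : ℝ, A₀ < σ → Tstar - Real.exp (-σ) ∈ Ioo (-δ₀) Tstar := by
    intro σ hσ
    refine ⟨?_, by linarith [Real.exp_pos (-σ)]⟩
    have : Real.exp (-σ) < Real.exp (-A₀) := Real.exp_lt_exp.2 (by linarith)
    rw [hexpA₀] at this
    linarith
  have htime_le : ∀ σ : ℝ, A ≤ σ → Tstar - Real.exp (-σ) ∈ Ico 0 Tstar := by
    intro σ hσ
    refine ⟨?_, by linarith [Real.exp_pos (-σ)]⟩
    have : Real.exp (-σ) ≤ Real.exp (-A) := Real.exp_le_exp.2 (by linarith)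
    rw [hexpA] at this
    linarith
  have hA₀A : A₀ < A := by
    rw [hA₀, hA]
    exact neg_lt_neg (Real.log_lt_log hT (by linarith))
  have h0mem : (0 : ℝ) ∈ Ioo (-δ₀) Tstar := ⟨by linarith, hT⟩
  have hneg0 : ∀ n : ℤ, n < 0 → ∀ t ∈ Ico 0 Tstar, X n t = 0 :=
    negShells_eq_zero hΛ1 hlaw hreg h0mem hnn (fun n hn => hdata n hn.ne)
  refine ⟨hA₀A, by positivity, ?_, ?_, ?_, ?_, ?_, ?_⟩
  · have hinv : 0 < Λ⁻¹ := inv_pos.2 hΛ0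
    rw [mul_one_div, div_lt_one (by positivity)]
    nlinarith
  · intro n σ hσ
    exact hasDerivAt_renorm (T := Tstar) hΛ0 hlaw n (htime_lt σ hσ)
  · intro n σ hσ
    have ht := htime_le σ hσ
    have hX0 : 0 ≤ X n (Tstar - Real.exp (-σ)) := hnn n _ ht
    have h1 := htypeI n _ ht
    refine ⟨by positivity, ?_⟩
    have : Λ ^ n * (Real.exp (-σ) * X n (Tstar - Real.exp (-σ)))
        = Λ ^ n * X n (Tstar - Real.exp (-σ)) * (Tstar - (Tstar - Real.exp (-σ))) := by ring
    rw [this]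
    exact h1
  · intro n hn σ hσ
    rw [hneg0 n hn _ (htime_le σ hσ), mul_zero, mul_zero]
  · intro n hn
    rw [hexpA, sub_self, hdata n hn.ne', mul_zero, mul_zero]
  · intro σ hσ
    have ht := htime_le σ hσ
    obtain ⟨n, hn⟩ := exists_active_shell (a := -δ₀) hΛ0 hnn hlow ht (by linarith [ht.1])
    refine ⟨n, ?_⟩
    have : Λ ^ n * (Real.exp (-σ) * X n (Tstar - Real.exp (-σ)))
        = Λ ^ n * X n (Tstar - Real.exp (-σ)) * (Tstar - (Tstar - Real.exp (-σ))) := by ring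
    rw [this]
    exact hn.le

/-- **The unconditional firing clock of the one-shell dyadic Cauchy blow-up.**  For every `ε₀ > 0` and every
solution bundle `(T*, X)` as above, with `Λ = bigLam ε₀`, `W_n(σ) = Λⁿe^{−σ}X_n(T* − e^{−σ})`, `A = −log T*`,
`B = 2Λ²/(Λ−1)²`, `c = 1/(2(Λ+Λ⁻¹))`: there is a MONOTONE sequence of first-firing log-times `s` with `s 0 = A`,
`W_n(s_n) ≥ c`, `s_n` minimal among `{σ ≥ A : W_n(σ) ≥ c}`, such that
(leading edge) `W_{N+1+i}(σ) ≤ Λ⁻¹(Λc)^{2^i}` for `σ ∈ [s_N, s_{N+1})`,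
(speed limit) `s_{N+2m} ≥ s_N + m·c(1−Λc)/(ΛB²)`, and
(energy line) `s_{N+1} ≤ σ` whenever `σ ≥ A + 1` and `Λ^N e^{−σ} √E(A+1) < c`.  No post-firing hypothesis.
[cite: Tao2016AveragedNS, §1.2 (dyadic model), §4 Lemma 4.1 (4.8)/(4.10) with `m = 1`, §6.4; elementary] -/
theorem cauchy_firstFiring_clock {ε₀ : ℝ} (hε₀ : 0 < ε₀) {δ₀ Tstar : ℝ} (hδ₀ : 0 < δ₀)
    (hT : 0 < Tstar) {X : ℤ → ℝ → ℝ}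
    (hdata : ∀ n : ℤ, n ≠ 0 → X n 0 = 0)
    (hlaw : ∀ n : ℤ, ∀ t ∈ Ioo (-δ₀) Tstar, HasDerivAt (X n)
      (bigLam ε₀ ^ (n - 1) * X (n - 1) t ^ 2 - bigLam ε₀ ^ n * X n t * X (n + 1) t) t)
    (hreg : ∀ T', T' < Tstar → ∃ B : ℝ, ∀ n : ℤ, ∀ t ∈ Ioo (-δ₀) T', |bigLam ε₀ ^ n * X n t| ≤ B)
    (hnn : ∀ n : ℤ, ∀ t ∈ Ico 0 Tstar, 0 ≤ X n t)
    (htypeI : ∀ n : ℤ, ∀ t ∈ Ico 0 Tstar,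
      bigLam ε₀ ^ n * X n t * (Tstar - t) ≤ 2 * bigLam ε₀ ^ 2 / (bigLam ε₀ - 1) ^ 2)
    (hlow : ∀ t ∈ Ioo (-δ₀) Tstar, ∀ β : ℝ, 0 < β →
      (∀ n : ℤ, |bigLam ε₀ ^ n * X n t| ≤ β) → 1 ≤ (bigLam ε₀ + (bigLam ε₀)⁻¹) * β * (Tstar - t)) :
    ∃ s : ℕ → ℝ, Monotone s ∧ s 0 = -Real.log Tstar ∧ (∀ n : ℕ, -Real.log Tstar ≤ s n) ∧
      (∀ n : ℕ, 1 / (2 * (bigLam ε₀ + (bigLam ε₀)⁻¹))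
        ≤ bigLam ε₀ ^ (n : ℤ) * (Real.exp (-(s n)) * X n (Tstar - Real.exp (-(s n))))) ∧
      (∀ (n : ℕ) (σ : ℝ), -Real.log Tstar ≤ σ →
        1 / (2 * (bigLam ε₀ + (bigLam ε₀)⁻¹)) ≤ bigLam ε₀ ^ (n : ℤ) * (Real.exp (-σ) * X n (Tstar - Real.exp (-σ)))
          → s n ≤ σ) ∧
      (∀ (N i : ℕ) (σ : ℝ), s N ≤ σ → σ < s (N + 1) →
        bigLam ε₀ ^ ((N : ℤ) + 1 + i) * (Real.exp (-σ) * X ((N : ℤ) + 1 + i) (Tstar - Real.exp (-σ)))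
          ≤ (bigLam ε₀)⁻¹ * (bigLam ε₀ * (1 / (2 * (bigLam ε₀ + (bigLam ε₀)⁻¹)))) ^ (2 ^ i)) ∧
      (∀ N m : ℕ, s N + m * ((1 / (2 * (bigLam ε₀ + (bigLam ε₀)⁻¹)))
          * (1 - bigLam ε₀ * (1 / (2 * (bigLam ε₀ + (bigLam ε₀)⁻¹))))
          / (bigLam ε₀ * (2 * bigLam ε₀ ^ 2 / (bigLam ε₀ - 1) ^ 2) ^ 2)) ≤ s (N + 2 * m)) ∧
      (∀ (N : ℕ) (σ : ℝ), -Real.log Tstar + 1 ≤ σ →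
        bigLam ε₀ ^ N * Real.exp (-σ) * Real.sqrt (∑' j : ℕ, (bigLam ε₀)⁻¹ ^ (2 * j)
          * (Real.exp (2 * (-Real.log Tstar + 1))
            * (bigLam ε₀ ^ (j : ℤ) * (Real.exp (-(-Real.log Tstar + 1))
              * X j (Tstar - Real.exp (-(-Real.log Tstar + 1))))) ^ 2))
          < 1 / (2 * (bigLam ε₀ + (bigLam ε₀)⁻¹)) → s (N + 1) ≤ σ) := by
  obtain ⟨hA, hc, hΛc, hlaw', hbd, hneg, hstart, hrate⟩ :=
    cauchy_body hε₀ hδ₀ hT hdata hlaw hreg hnn htypeI hlow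
  set Λ : ℝ := bigLam ε₀ with hΛdef
  have hΛ1 : 1 < Λ := by
    rw [hΛdef]; unfold bigLam; exact Real.one_lt_rpow (by linarith) (by norm_num)
  have hΛ0 : 0 < Λ := by linarith
  set W : ℤ → ℝ → ℝ := fun n σ => Λ ^ n * (Real.exp (-σ) * X n (Tstar - Real.exp (-σ))) with hW
  set A₀ : ℝ := -Real.log (Tstar + δ₀) with hA₀
  set A : ℝ := -Real.log Tstar with hAdef
  set c : ℝ := 1 / (2 * (Λ + Λ⁻¹)) with hcdef
  set B : ℝ := 2 * Λ ^ 2 / (Λ - 1) ^ 2 with hBdef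
  have hlawW : ∀ (n : ℤ) (σ : ℝ), A₀ < σ → HasDerivAt (W n)
      (-(W n σ) + Λ * W (n - 1) σ ^ 2 - Λ⁻¹ * W n σ * W (n + 1) σ) σ := hlaw'
  have hnnW : ∀ (n : ℤ) (σ : ℝ), A ≤ σ → 0 ≤ W n σ := fun n σ hσ => (hbd n σ hσ).1
  have hBW : ∀ (n : ℤ) (σ : ℝ), A ≤ σ → W n σ ≤ B := fun n σ hσ => (hbd n σ hσ).2
  have hnegW : ∀ n : ℤ, n < 0 → ∀ σ : ℝ, A ≤ σ → W n σ = 0 := hneg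
  have hstartW : ∀ n : ℤ, 0 < n → W n A = 0 := hstart
  have hrateW : ∀ σ : ℝ, A ≤ σ → ∃ n : ℤ, c ≤ W n σ := hrate
  obtain ⟨s, hs1, hs2, hs3⟩ :=
    exists_firstFiring_of_energy hΛ1 hA hc hΛc.le hlawW hnnW hBW hnegW hstartW hrateW
  have hmono : Monotone s := firstFiring_mono hΛ0 hA hc hΛc.le hlawW hnnW hstartW hs1 hs2 hs3
  have hs0 : s 0 = A := firstFiring_zero hc hnegW hstartW hrateW hs1 hs3
  have hσE : A < A + 1 := by linarith
  refine ⟨s, hmono, hs0, hs1, hs2, hs3, fun N i σ h1 h2 => ?_, fun N m => ?_, fun N σ hσ hline => ?_⟩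
  · exact leadingEdge hΛ0 hA hc hΛc.le hlawW hnnW hnegW hstartW hrateW hs1 hs3 hmono N i ⟨h1, h2⟩
  · exact firstFiring_ge_linear hΛ0 hA hc hΛc.le hlawW hnnW hBW hnegW hstartW hrateW hs1 hs2 hs3 hmono N m
  · exact firstFiring_succ_le_of_energy_line hΛ1 hA hc hΛc.le hlawW hnnW hBW hnegW hstartW hrateW hs3 hσE N
      hσ hline

end WakeRatchetDyadicPostFiring

end Summit.NavierStokesRegularity.NavierStokesRegularity.Theorems

end
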